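import Literature.Probability.RandomPlanarGeometry.HexSAWArmchairWallBridges
import Literature.Probability.RandomPlanarGeometry.HexSAWRotSurfaceYcLimit
import Literature.Probability.RandomPlanarGeometry.HexSAWRotSlabSummable
import HarnessLib

/-!
# Beaton's rotated half-plane in the brick wall: `C⁺_{n+1}(y) = C^w_n(y)`, and the all-`y` limit `μ(y) = max(β_rot(y), μ)`
# GIVEN the unfolding face «ARM-ARCH-BOUND»

Topic `Literature/Probability/RandomPlanarGeometry` (lane «pcv-sawmu», door «HEX-YC-ROT-LIMIT-ALL-Y», Part C; continues
`HexSAWArmchairWallBridges.lean` — `hp`, `Cw`, `armRate`, `ArchBound`, `eventually_mul_pow_le_Cw`, `eventually_Cw_le_pow` —, R4/R5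
`HexSAWRotSurfaceYcGrowth.lean` / `HexSAWRotSurfaceYcLimit.lean` — `rotHpWalks`, `rotHpCoeff n y = C⁺_n(y)`, `RotGrowthGeRate`,
`rotGrowthGeRate_mu_of_pos`, `tendsto_rotHpCoeff_rpow_iff` — and `HexSAWRotSlabSummable.lean` — the chart `toSlabBW`, `toSlabBW_zero`,
`rhoInv`).  The unconditional capstone is `HexSAWRotSurfaceYcLimitAllY.lean`.

Sources. N. R. Beaton, J. Phys. A 47 (2014) 075003, arXiv:1210.0274v3, §2 (Fig. 1: the rotated frame), §3.1 (p. 11: `c^+_n(m)`,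
`C^+_n(y)`; Proposition 7, p. 11, and its proof pp. 12–14); J. M. Hammersley, G. M. Torrie, S. G. Whittington, J. Phys. A 15 (1982) 539, §2;
N. Madras, G. Slade, *The Self-Avoiding Walk* (1993), §1.1 (walks as vertex lists / vertex functions); I. G. Enting, I. Jensen, LNP 775
(2009), §7.4.2, Fig. 7.10.

## What is proved (all PROVED; namespace `…SAW.HV`)

* the armchair chart as a graph isomorphism `achIso : ℍ ≃g brick wall` (`= toSlabBW` on vertices, `toSlabBW_hvOrigin : O ↦ 0`) and the
  weight-preserving bijection `armOf n : rotHpWalks (n+1) → hp n` (`armOf_mem_hp`, `surfCount_eq_visits`, `armOf_injOn`, `armOf_surjOn`);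
* **`rotHpCoeff_succ_eq : rotHpCoeff (n+1) y = Cw n y`** — Beaton's `C⁺_{n+1}(y)` IS the armchair `C`-class sum with `n` steps;
* `rotSurfaceMu y := max (armRate y) μ`, `rotGrowthGeRate_armRate`, `rotGrowthGeRate_rotSurfaceMu` (`liminf ≥`, rate form, tree + Part A),
  `tendsto_rotHpCoeff_rpow_of_squeeze` (squeeze at a general value);
* GIVEN the face: `eventually_rotHpCoeff_le_pow_of_archBound`, **`tendsto_rotHpCoeff_rpow_of_archBound`** (`C⁺_n(y)^{1/n} → μ_rot(y)`),
  `rotSurfaceMu_eq_iff_of_archBound` (`μ_rot(y) = μ ↔ y ≤ y†`), `hexConnectiveConstant_lt_rotSurfaceMu_iff_of_archBound`,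
  `hexConnectiveConstant_lt_armRate_iff_of_archBound`.

LABEL: CONSOLIDATION (dictionary step between Beaton's vertex-list half-plane walks and the brick-wall function model; the assembly of
Proposition 7 sentence 1 from its two halves).
-/

noncomputable section

open Finset Filter Function
open Literature.Probability.LatticeModels Literature.Probability.Percolation SimpleGraph
open _root_.Topology

namespace Literature.Probability.RandomPlanarGeometry.SAW.HV

open HexBW.Arm

variable {y : ℝ} {n : ℕ}

/-! ### The chart `HV → ℤ²`, `v ↦ hvToBW (ρ⁻¹ v)`: Beaton's height `−ξ` becomes the brick-wall abscissa `X` -/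

/-- `ρ⁻¹ ∘ ρ = id`. [cite: Beaton2014RotatedHoneycomb, §2 (Fig. 1)] -/
theorem rhoInv_rho (v : HV) : rhoInv (rho v) = v := rho_injective (rho_rhoInv (rho v))

/-- `ρ⁻¹` as a graph automorphism of `ℍ`. [cite: Beaton2014RotatedHoneycomb, §2 (Fig. 1: the rotation)] -/
def rhoInvIso : hvGraph ≃g hvGraph where
  toFun := rhoInv
  invFun := rho
  left_inv := fun u => rho_rhoInv u
  right_inv := fun v => rhoInv_rho v
  map_rel_iff' := by
    intro u v
    refine ⟨fun h => ?_, rhoInv_adj⟩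
    have := rho_adj h
    simp only [Equiv.coe_fn_mk, rho_rhoInv] at this
    exact this

/-- **The armchair chart** `𝔞 : ℍ ≃g brick wall`, `v ↦ hvToBW (ρ⁻¹ v)` (= the tree's `toSlabBW`): `𝔞 v 0 = −ξ v`, so Beaton's half-plane
`{ξ ≤ 0}` is `{X ≥ 0}` and his surface `{ξ = 0}` is the armchair column `{X = 0}`. [cite: Beaton2014RotatedHoneycomb, §2 (Fig. 1), §3.1 (the half-plane); EntingJensen2009, §7.4.2, Fig. 7.10] -/
def achIso : hvGraph ≃g brickWallGraph := rhoInvIso.trans bwIso.symm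

/-- The chart is `toSlabBW` on vertices. [cite: Beaton2014RotatedHoneycomb, §2 (Fig. 1: the rotated frame); EntingJensen2009, §7.4.2, Fig. 7.10] -/
theorem achIso_apply (v : HV) : achIso v = toSlabBW v := rfl

/-- The chart as a function is `toSlabBW`. [cite: Beaton2014RotatedHoneycomb, §2 (Fig. 1: the rotated frame); EntingJensen2009, §7.4.2, Fig. 7.10] -/
theorem coe_achIso : (⇑achIso : HV → Site 2) = toSlabBW := funext achIso_apply

/-- The chart sends `O` to `0`. [cite: Beaton2014RotatedHoneycomb, §2 (Fig. 1: the rotated frame); EntingJensen2009, §7.4.2, Fig. 7.10] -/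
theorem toSlabBW_hvOrigin : toSlabBW hvOrigin = 0 := by
  have h1 : rhoInv hvOrigin = hvOrigin := by decide
  rw [toSlabBW, h1, ← bwToHV_zero, ← bwIso_apply, RelIso.symm_apply_apply]

/-- The inverse chart undoes `toSlabBW`. [cite: Beaton2014RotatedHoneycomb, §2 (Fig. 1: the rotated frame); EntingJensen2009, §7.4.2, Fig. 7.10] -/
theorem achIso_symm_toSlabBW (v : HV) : achIso.symm (toSlabBW v) = v := by
  rw [← achIso_apply]; exact RelIso.symm_apply_apply achIso v

/-- `toSlabBW` undoes the inverse chart. [cite: Beaton2014RotatedHoneycomb, §2 (Fig. 1: the rotated frame); EntingJensen2009, §7.4.2, Fig. 7.10] -/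
theorem toSlabBW_achIso_symm (x : Site 2) : toSlabBW (achIso.symm x) = x := by
  rw [← achIso_apply]; exact RelIso.apply_symm_apply achIso x

/-! ### The dictionary: rotated half-plane walks with `n + 1` vertices ↔ armchair half-plane walks with `n` steps -/

/-- The brick-wall walk (`n` steps, function model) of an `(n+1)`-vertex list of `ℍ` under the armchair chart.
[cite: MadrasSlade1993, §1.1] -/
def armOf (n : ℕ) (l : List HV) : ℕ → Site 2 := HexBW.ofList n (l.map toSlabBW)

/-- A rotated half-plane walk is a self-avoiding list from `O`. [cite: Beaton2014RotatedHoneycomb, §3.1 (arXiv v3 p. 11: c^+_n(m))] -/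
theorem mem_sawLists_of_mem_rotHpWalks {l : List HV} (hl : l ∈ rotHpWalks (n + 1)) : l ∈ sawLists hvGraph hvOrigin n := by
  obtain ⟨hc, hh, hnd, hlen, -⟩ := mem_rotHpWalks_iff.1 hl
  exact mem_sawLists_iff.2 ⟨hc, hh, hlen, hnd⟩

/-- Its chart image is a self-avoiding brick-wall list from `0`. [cite: MadrasSlade1993, §1.1] -/
theorem map_toSlabBW_mem_sawLists {l : List HV} (h : l ∈ sawLists hvGraph hvOrigin n) :
    l.map toSlabBW ∈ sawLists brickWallGraph (0 : Site 2) n := by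
  have h' := (map_mem_sawLists_iff achIso (v := hvOrigin) (n := n) (l := l)).2 h
  rwa [coe_achIso, toSlabBW_hvOrigin] at h'

/-- `armOf n l` is an `n`-step brick-wall SAW from `0`. [cite: MadrasSlade1993, §1.1] -/
theorem armOf_mem_saws {l : List HV} (h : l ∈ sawLists hvGraph hvOrigin n) : armOf n l ∈ HexBW.saws n := by
  have := Set.mem_image_of_mem (HexBW.ofList n) (map_toSlabBW_mem_sawLists h)
  rw [HexBW.ofList_image] at this
  exact Finset.mem_coe.1 this

/-- Values: the wall walk at time `i ≤ n` is the chart of the `i`-th vertex. [cite: Beaton2014RotatedHoneycomb, §3.1 (arXiv v3 p. 11: c^+_n(m), C^+_n(y), unfolded walks; proof of Proposition 7 pp. 12–14)] -/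
theorem armOf_apply {l : List HV} (hl : l.length = n + 1) {i : ℕ} (hi : i ≤ n) : armOf n l i = toSlabBW (l[i]'(by omega)) := by
  unfold armOf HexBW.ofList
  rw [min_eq_left hi, List.getD_eq_getElem _ _ (by rw [List.length_map]; omega), List.getElem_map]

/-- `armOf` maps rotated half-plane walks into the armchair `C`-class. [cite: Beaton2014RotatedHoneycomb, §3.1 (arXiv v3 p. 11)] -/
theorem armOf_mem_hp {l : List HV} (hl : l ∈ rotHpWalks (n + 1)) : armOf n l ∈ hp n := by
  have hs := mem_sawLists_of_mem_rotHpWalks hl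
  have hlen : l.length = n + 1 := (mem_sawLists_iff.1 hs).2.2.1
  have hV := (mem_rotHpWalks_iff.1 hl).2.2.2.2
  refine mem_hp.2 ⟨armOf_mem_saws hs, fun i hi => ?_⟩
  rw [armOf_apply hlen hi, toSlabBW_zero]
  exact hV _ (List.getElem_mem _)

/-- `visits` as a count over `range`. [cite: Beaton2014RotatedHoneycomb, §3.1 (arXiv v3 p. 11: c^+_n(m), C^+_n(y), unfolded walks; proof of Proposition 7 pp. 12–14)] -/
theorem visits_eq_countP (ω : ℕ → Site 2) (m : ℕ) :
    visits m ω = (List.range (m + 1)).countP (fun i => decide (ω i 0 = 0)) := by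
  induction m with
  | zero =>
    rw [visits_zero, show List.range (0 + 1) = [0] from rfl, List.countP_singleton]
    by_cases h : ω 0 0 = 0 <;> simp [h]
  | succ m ih =>
    rw [show List.range (m + 1 + 1) = List.range (m + 1) ++ [m + 1] from List.range_succ, List.countP_append,
      List.countP_singleton, ← ih, visits_succ]
    by_cases h : ω (m + 1) 0 = 0 <;> simp [h]

/-- **Surface vertices = wall visits**: `surfCount l = visits n (armOf n l)`. [cite: Beaton2014RotatedHoneycomb, §3.1 (arXiv v3 p. 11: "occupying m vertices in the surface")] -/
theorem surfCount_eq_visits {l : List HV} (hl : l ∈ rotHpWalks (n + 1)) : surfCount l = visits n (armOf n l) := by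
  have hs := mem_sawLists_of_mem_rotHpWalks hl
  have hlen : l.length = n + 1 := (mem_sawLists_iff.1 hs).2.2.1
  -- a list is the map of its entries over `range`
  have hmap : (List.range l.length).map (fun i => l.getD i hvOrigin) = l :=
    List.ext_getElem (by simp) fun i h1 h2 => by
      rw [List.getElem_map, List.getElem_range, List.getD_eq_getElem _ _ h2]
  rw [surfCount, ← List.countP_eq_length_filter, visits_eq_countP]
  conv_lhs => rw [← hmap]
  rw [List.countP_map, hlen]
  refine List.countP_congr fun i hi => ?_
  rw [List.mem_range] at hi
  simp only [Function.comp_apply, decide_eq_true_eq]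
  rw [armOf_apply hlen (by omega), toSlabBW_zero, List.getD_eq_getElem _ _ (by omega)]
  omega

/-- `armOf n` is injective on rotated half-plane walks. [cite: MadrasSlade1993, §1.1] -/
theorem armOf_injOn (n : ℕ) : Set.InjOn (armOf n) ↑(rotHpWalks (n + 1)) := by
  intro l hl l' hl' h
  have h1 := HexBW.ofList_injOn n (map_toSlabBW_mem_sawLists (mem_sawLists_of_mem_rotHpWalks hl))
    (map_toSlabBW_mem_sawLists (mem_sawLists_of_mem_rotHpWalks hl')) h
  exact (List.map_injective_iff.2 toSlabBW_injective) h1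

/-- `armOf n` maps onto the armchair `C`-class. [cite: MadrasSlade1993, §1.1] -/
theorem armOf_surjOn (n : ℕ) : Set.SurjOn (armOf n) ↑(rotHpWalks (n + 1)) ↑(hp n) := by
  intro ω hω
  rw [Finset.mem_coe] at hω
  obtain ⟨hωs, hH⟩ := mem_hp.1 hω
  have hω' : ω ∈ (↑(HexBW.saws n) : Set (ℕ → Site 2)) := Finset.mem_coe.2 hωs
  rw [← HexBW.ofList_image] at hω'
  obtain ⟨L, hL, hLω⟩ := hω'
  set l := L.map achIso.symm with hl
  have hlL : l.map toSlabBW = L := by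
    rw [hl, List.map_map]
    conv_rhs => rw [← List.map_id L]
    refine List.map_congr_left fun x _ => ?_
    exact toSlabBW_achIso_symm x
  have hls : l ∈ sawLists hvGraph hvOrigin n := by
    have := (map_mem_sawLists_iff achIso.symm (v := (0 : Site 2)) (n := n) (l := L)).2 hL
    have h0 : achIso.symm (0 : Site 2) = hvOrigin := by rw [← toSlabBW_hvOrigin]; exact achIso_symm_toSlabBW _
    rwa [h0] at this
  obtain ⟨hc, hh, hlen, hnd⟩ := mem_sawLists_iff.1 hls
  have hLlen : L.length = n + 1 := by rw [← hlL, List.length_map, hlen]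
  refine ⟨l, Finset.mem_coe.2 (mem_rotHpWalks_iff.2 ⟨hc, hh, hnd, hlen, fun v hv => ?_⟩), ?_⟩
  · obtain ⟨i, hi, rfl⟩ := List.getElem_of_mem hv
    have hi' : i ≤ n := by omega
    have e : ω i 0 = toSlabBW (l[i]) 0 := by
      rw [← hLω, ← hlL]
      unfold HexBW.ofList
      rw [min_eq_left hi', List.getD_eq_getElem _ _ (by rw [List.length_map]; omega), List.getElem_map]
    rw [← toSlabBW_zero, ← e]
    exact hH i hi'
  · rw [armOf, hlL, hLω]

/-- **`C⁺_{n+1}(y) = C^w_n(y)`**: Beaton's rotated half-plane partition function with `n + 1` vertices IS the armchair-wall `C`-class sum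
with `n` steps (weight-preserving bijection `armOf n`). [cite: Beaton2014RotatedHoneycomb, §3.1 (arXiv v3 p. 11: C^+_n(y) = Σ_m c^+_n(m) y^m)] -/
theorem rotHpCoeff_succ_eq (n : ℕ) (y : ℝ) : rotHpCoeff (n + 1) y = Cw n y := by
  rw [rotHpCoeff, Cw]
  exact Finset.sum_nbij (armOf n) (fun l hl => armOf_mem_hp hl) (armOf_injOn n) (armOf_surjOn n)
    fun l hl => by rw [surfCount_eq_visits hl]

/-! ### The all-`y` limit GIVEN the face «ARM-ARCH-BOUND» -/

/-- **`μ_rot(y) := max(β_rot(y), μ)`** — the value of Beaton's limit `μ(y) = lim_n C⁺_n(y)^{1/n}` in the rotated frame (proved below to BE the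
limit, given the unfolding face; unconditionally in `HexSAWRotSurfaceYcLimitAllY.lean`).
[cite: Beaton2014RotatedHoneycomb, Proposition 7 (arXiv v3 p. 11: "μ(y) := lim C_n^+(y)^{1/n} exists and is finite"); HammersleyTorrieWhittington1982, §2] -/
def rotSurfaceMu (y : ℝ) : ℝ := max (armRate y) hexConnectiveConstant

/-- `μ_rot(y) > 0`. [cite: Beaton2014RotatedHoneycomb, Proposition 7 (arXiv v3 p. 11)] -/
theorem rotSurfaceMu_pos (y : ℝ) : 0 < rotSurfaceMu y := lt_max_of_lt_left (armRate_pos y)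

/-- `μ ≤ μ_rot(y)`. [cite: Beaton2014RotatedHoneycomb, Proposition 7 (arXiv v3 p. 11: "μ(y) ≥ max{μ, √y}")] -/
theorem hexConnectiveConstant_le_rotSurfaceMu (y : ℝ) : hexConnectiveConstant ≤ rotSurfaceMu y := le_max_right _ _

/-- `β_rot(y) ≤ μ_rot(y)`. [cite: Beaton2014RotatedHoneycomb, Proposition 7 (arXiv v3 p. 11)] -/
theorem armRate_le_rotSurfaceMu (y : ℝ) : armRate y ≤ rotSurfaceMu y := le_max_left _ _

/-- **`liminf C⁺_n(y)^{1/n} ≥ β_rot(y)`** (rate form): wall bridges extended away from the wall are half-plane walks.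
[cite: Beaton2014RotatedHoneycomb, §3.1, proof of Proposition 7 (arXiv v3 p. 14: "U^+_n(y) ≤ C^+_n(y), and hence μ(y) ≤ liminf C^+_n(y)^{1/n}")] -/
theorem rotGrowthGeRate_armRate (hy : 0 < y) : RotGrowthGeRate y (armRate y) := by
  intro r hr0 hr
  rcases hr0.eq_or_lt with rfl | hr0'
  · filter_upwards [eventually_ge_atTop 1] with n hn
    rw [zero_pow (by omega)]
    exact rotHpCoeff_nonneg n hy.le
  · obtain ⟨N, hN⟩ := eventually_atTop.1 (eventually_mul_pow_le_Cw hy r hr0' hr)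
    refine eventually_atTop.2 ⟨N + 1, fun n hn => ?_⟩
    obtain ⟨m, rfl⟩ : ∃ m, n = m + 1 := ⟨n - 1, by omega⟩
    rw [rotHpCoeff_succ_eq, pow_succ, mul_comm]
    exact hN m (by omega)

/-- **`liminf C⁺_n(y)^{1/n} ≥ μ_rot(y)`** (rate form; the `μ` half is R5's `rotGrowthGeRate_mu_of_pos`).
[cite: Beaton2014RotatedHoneycomb, Proposition 7 (arXiv v3 p. 11: "μ(y) ≥ max{μ, √y}")] -/
theorem rotGrowthGeRate_rotSurfaceMu (hy : 0 < y) : RotGrowthGeRate y (rotSurfaceMu y) := by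
  rcases le_total (armRate y) hexConnectiveConstant with h | h
  · rw [rotSurfaceMu, max_eq_right h]; exact rotGrowthGeRate_mu_of_pos hy
  · rw [rotSurfaceMu, max_eq_left h]; exact rotGrowthGeRate_armRate hy

/-- **`limsup C⁺_n(y)^{1/n} ≤ μ_rot(y)`** (rate form), GIVEN the face: for every `r > μ_rot(y)`, eventually `C⁺_n(y) ≤ rⁿ`.
[cite: Beaton2014RotatedHoneycomb, §3.1, proof of Proposition 7 (arXiv v3 p. 14: "limsup C^+_n(y)^{1/n} ≤ μ(y)")] -/
theorem eventually_rotHpCoeff_le_pow_of_archBound (hy : 0 < y) (hA : ArchBound y) {r : ℝ} (hr : rotSurfaceMu y < r) :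
    ∀ᶠ n : ℕ in atTop, rotHpCoeff n y ≤ r ^ n := by
  have hμ1 : 1 < hexConnectiveConstant := by
    rw [hexConnectiveConstant_eq_inv]
    exact (one_lt_inv₀ hexCriticalFugacity_pos_lt_one.1).2 hexCriticalFugacity_pos_lt_one.2
  have hr1 : 1 ≤ r := (hμ1.le.trans (hexConnectiveConstant_le_rotSurfaceMu y)).trans hr.le
  obtain ⟨N, hN⟩ := eventually_atTop.1 (eventually_Cw_le_pow hy hA hr)
  refine eventually_atTop.2 ⟨N + 1, fun n hn => ?_⟩
  obtain ⟨m, rfl⟩ : ∃ m, n = m + 1 := ⟨n - 1, by omega⟩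
  rw [rotHpCoeff_succ_eq, pow_succ]
  calc Cw m y ≤ r ^ m := hN m (by omega)
    _ = r ^ m * 1 := (mul_one _).symm
    _ ≤ r ^ m * r := mul_le_mul_of_nonneg_left hr1 (pow_nonneg (zero_le_one.trans hr1) _)

/-- **Squeeze at a general value**: if every rate below `L` is eventually dominated by `C⁺_n(y)` and every rate above `L` eventually dominates it,
then `C⁺_n(y)^{1/n} → L`. [cite: Beaton2014RotatedHoneycomb, §3.1, proof of Proposition 7 (arXiv v3 pp. 12–14)] -/
theorem tendsto_rotHpCoeff_rpow_of_squeeze (hy : 0 ≤ y) {L : ℝ} (hL : 0 < L) (hge : RotGrowthGeRate y L)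
    (hle : ∀ r : ℝ, L < r → ∀ᶠ n : ℕ in atTop, rotHpCoeff n y ≤ r ^ n) :
    Tendsto (fun n : ℕ => rotHpCoeff n y ^ ((n : ℝ)⁻¹)) atTop (𝓝 L) := by
  rw [tendsto_order]
  constructor
  · intro a ha
    set r := (max a 0 + L) / 2 with hr_def
    have hmax : max a 0 < L := max_lt ha hL
    have hr0 : 0 ≤ r := by rw [hr_def]; have := le_max_right a 0; linarith
    have har : a < r := by rw [hr_def]; have := le_max_left a 0; linarith
    have hrL : r < L := by rw [hr_def]; linarith
    filter_upwards [hge r hr0 hrL, eventually_ne_atTop 0] with n hn hn0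
    calc a < r := har
      _ = (r ^ n) ^ ((n : ℝ)⁻¹) := (Real.pow_rpow_inv_natCast hr0 hn0).symm
      _ ≤ rotHpCoeff n y ^ ((n : ℝ)⁻¹) := Real.rpow_le_rpow (pow_nonneg hr0 n) hn (inv_nonneg.2 (Nat.cast_nonneg n))
  · intro b hb
    set r := (b + L) / 2 with hr_def
    have hLr : L < r := by rw [hr_def]; linarith
    have hrb : r < b := by rw [hr_def]; linarith
    have hr0 : 0 ≤ r := hL.le.trans hLr.le
    filter_upwards [hle r hLr, eventually_ne_atTop 0] with n hn hn0
    calc rotHpCoeff n y ^ ((n : ℝ)⁻¹) ≤ (r ^ n) ^ ((n : ℝ)⁻¹) :=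
          Real.rpow_le_rpow (rotHpCoeff_nonneg n hy) hn (inv_nonneg.2 (Nat.cast_nonneg n))
      _ = r := Real.pow_rpow_inv_natCast hr0 hn0
      _ < b := hrb

/-- **Beaton 2014 Proposition 7, first sentence, for EVERY `y > 0`, GIVEN the face «ARM-ARCH-BOUND»**: `C⁺_n(y)^{1/n} → μ_rot(y) = max(β_rot(y), μ)`.
[cite: Beaton2014RotatedHoneycomb, Proposition 7 (arXiv v3 p. 11: "μ(y) := lim_{n→∞} C_n^+(y)^{1/n} exists and is finite")] -/
theorem tendsto_rotHpCoeff_rpow_of_archBound (hy : 0 < y) (hA : ArchBound y) :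
    Tendsto (fun n : ℕ => rotHpCoeff n y ^ ((n : ℝ)⁻¹)) atTop (𝓝 (rotSurfaceMu y)) :=
  tendsto_rotHpCoeff_rpow_of_squeeze hy.le (rotSurfaceMu_pos y) (rotGrowthGeRate_rotSurfaceMu hy)
    fun _ hr => eventually_rotHpCoeff_le_pow_of_archBound hy hA hr

/-- **`μ_rot(y) = μ ↔ y ≤ y†`** (GIVEN the face): the limit value against Beaton's critical fugacity, through R5's dichotomy
`tendsto_rotHpCoeff_rpow_iff`. [cite: Beaton2014RotatedHoneycomb, Theorem 1 (arXiv v3 p. 2) and Proposition 7 (p. 11: "μ(y) = μ if y ≤ y_c, > μ if y > y_c")] -/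
theorem rotSurfaceMu_eq_iff_of_archBound (hy : 0 < y) (hA : ArchBound y) :
    rotSurfaceMu y = hexConnectiveConstant ↔ y ≤ rotYdagger := by
  rw [← tendsto_rotHpCoeff_rpow_iff hy]
  constructor
  · intro h; rw [← h]; exact tendsto_rotHpCoeff_rpow_of_archBound hy hA
  · intro h; exact tendsto_nhds_unique (tendsto_rotHpCoeff_rpow_of_archBound hy hA) h

/-- **`μ < μ_rot(y) ↔ y > y†`** (GIVEN the face). [cite: Beaton2014RotatedHoneycomb, Proposition 7 (arXiv v3 p. 11: "μ(y) > μ if y > y_c")] -/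
theorem hexConnectiveConstant_lt_rotSurfaceMu_iff_of_archBound (hy : 0 < y) (hA : ArchBound y) :
    hexConnectiveConstant < rotSurfaceMu y ↔ rotYdagger < y := by
  have h := rotSurfaceMu_eq_iff_of_archBound hy hA
  have hle := hexConnectiveConstant_le_rotSurfaceMu y
  constructor
  · intro hlt; by_contra hc; rw [not_lt] at hc; exact hlt.ne' (h.2 hc)
  · intro hlt; exact lt_of_le_of_ne hle fun e => (not_le.2 hlt) (h.1 e.symm)

/-- **`μ < β_rot(y) ↔ y > y†`** (GIVEN the face): above Beaton's `y_c` the armchair wall bridges alone grow faster than `μ`.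
[cite: Beaton2014RotatedHoneycomb, Proposition 7 (arXiv v3 p. 11); HammersleyTorrieWhittington1982, §2] -/
theorem hexConnectiveConstant_lt_armRate_iff_of_archBound (hy : 0 < y) (hA : ArchBound y) :
    hexConnectiveConstant < armRate y ↔ rotYdagger < y := by
  rw [← hexConnectiveConstant_lt_rotSurfaceMu_iff_of_archBound hy hA, rotSurfaceMu]
  constructor
  · intro h; exact lt_max_of_lt_left h
  · intro h
    rcases lt_max_iff.1 h with h | h
    · exact h
    · exact absurd h (lt_irrefl _)

end Literature.Probability.RandomPlanarGeometry.SAW.HV
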